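import Summits.CriticalPhenomena.CardyFormulaZ2.Theorems.CardyUniqueLimitCardyRigidityKernelODETaylor

/-!
# The maximum principle for kernels with the asymptotic mean-value property (line `crossing-martingale`, crux `CardyRigidity`)

Pure real analysis, Mathlib + the toolkit file `…KernelODETaylor`; second `KernelODE` file of stub
`stub_kernelAffineBeta` (crux `CardyRigidity`, stmt-CriticalPhenomena-0746).  THEOREM
(`sub_le_max_of_mvp`): let `f` be continuous on `[p, q]` with the asymptotic mean-value property
at every interior point `η` — along `n → ∞` there are probability measures `ν_n` on `ℝ` carried by
`[-r_n, r_n]`, `r_n → 0`, with `f η = ∫ f (η + x) dν_n` EXACTLY, `∫ x dν_n = α η/n² + o(n⁻²)` and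
`∫ x² dν_n = β η/n² + o(n⁻²)` (`α, β` continuous on `[p, q]`, `β > 0`; this is what the probabilistic
half of the line delivers from the crossing-martingale property) —
and let `u` be continuous on `[p, q]`, `C²` inside with continuous `u''`, solving the generator
equation `(β/2) u'' + α u' = 0`; then `f - u ≤ max ((f - u) p) ((f - u) q)` on `[p, q]`.  This is the
viscosity comparison argument in one dimension and uses NO regularity of `f`: if the maximum were
interior, perturb by `ε exp(K·)` (a strict subsolution once `(β/2)K² + αK > 0`), take an interior
maximum point `η*` of `f - u + ε exp(K·)`, and expand `u` and `exp(K·)` to second order against the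
measures `ν_n` of the mean-value property at `η*` (`abs_integral_shift_sub_main_le`): the integral of
the perturbed function exceeds its value at `η*` by `ε c/n² - o(n⁻²)`, `c > 0`, contradicting
maximality.  With the minimum principle (apply to `-f, -u`) it identifies `f` on `[p, q]` with the
solution of the generator equation having its boundary values (file `…KernelODERigidity`).
-/

noncomputable section

open MeasureTheory Filter Set Topology
open scoped BigOperators

namespace Summit.CriticalPhenomena.CardyFormulaZ2.Cruxes.CardyRigidity.CrossingMartingale

namespace KernelODE

/-! ### The maximum principle -/

/-- Arithmetic of the comparison argument: the one-sided expansions of `u` and `g` combine.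
[folklore] -/
theorem key_arith {ε c N C e m₂ θu θg Iu Ig Au Ag : ℝ} (hε : 0 ≤ ε)
    (Hu : Iu ≤ Au * (e / N) + θu * m₂) (Hg : -(Ag * (e / N) + θg * m₂) ≤ Ig - c / N)
    (hC : C * (e / N) = Au * (e / N) + ε * (Ag * (e / N))) :
    ε * c / N - C * (e / N) - (θu + ε * θg) * m₂ ≤ -Iu + ε * Ig := by
  have h := mul_le_mul_of_nonneg_left Hg hε
  have h1 : ε * -(Ag * (e / N) + θg * m₂) = -(ε * (Ag * (e / N))) - ε * θg * m₂ := by ring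
  have h2 : ε * (Ig - c / N) = ε * Ig - ε * c / N := by ring
  rw [h1, h2] at h
  have h3 : (θu + ε * θg) * m₂ = θu * m₂ + ε * θg * m₂ := by ring
  rw [h3, hC]
  linarith

/-- **Maximum principle for kernels with the asymptotic mean-value property.**  Let `f` be
continuous on `[p, q]` with the asymptotic mean-value property at every interior point `η` (along
`n → ∞`, probability measures `ν_n` carried by `[-r_n, r_n]`, `r_n → 0`, with `f η = ∫ f (η + x) dν_n`
exactly, `∫ x dν_n = α η/n² + o(n⁻²)`, `∫ x² dν_n = β η/n² + o(n⁻²)`), `α, β` continuous on `[p, q]`,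
`β > 0`.  Let `u` be continuous on
`[p, q]`, `C²` in the interior with `u'' = u₂` continuous there, solving the generator equation
`(β/2) u'' + α u' = 0`.  Then `f - u` attains its maximum over `[p, q]` on the boundary.
Proof: otherwise perturb by `ε exp(K·)` with `(β/2) K² + α K > 0`, take an interior maximum point
`η*` of `f - u + ε exp(K·)` and expand `u`, `exp(K·)` to second order against the measures `ν_n`
of the mean-value property at `η*`: the integral exceeds the value at `η*` by `ε c/n² + o(n⁻²)`,
`c > 0`, contradicting maximality. [folklore] -/
theorem sub_le_max_of_mvp {f u u₁ u₂ α β : ℝ → ℝ} {p q : ℝ} (hpq : p ≤ q)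
    (hf : ContinuousOn f (Icc p q)) (hu : ContinuousOn u (Icc p q))
    (hmvp : ∀ η ∈ Ioo p q, ∃ r e : ℕ → ℝ, Tendsto r atTop (𝓝 0) ∧ Tendsto e atTop (𝓝 0) ∧
      ∀ᶠ n : ℕ in atTop, ∃ ν : Measure ℝ, IsProbabilityMeasure ν ∧ ν (Icc (-(r n)) (r n))ᶜ = 0 ∧
        f η = ∫ x, f (η + x) ∂ν ∧
        |∫ x, x ∂ν - α η / (n : ℝ) ^ 2| ≤ e n / (n : ℝ) ^ 2 ∧
        |∫ x, x ^ 2 ∂ν - β η / (n : ℝ) ^ 2| ≤ e n / (n : ℝ) ^ 2)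
    (hα : ContinuousOn α (Icc p q)) (hβ : ContinuousOn β (Icc p q))
    (hβ0 : ∀ η ∈ Icc p q, 0 < β η)
    (hud : ∀ η ∈ Ioo p q, HasDerivAt u (u₁ η) η) (hu₁d : ∀ η ∈ Ioo p q, HasDerivAt u₁ (u₂ η) η)
    (hu₂ : ContinuousOn u₂ (Ioo p q))
    (hode : ∀ η ∈ Ioo p q, β η / 2 * u₂ η + α η * u₁ η = 0) :
    ∀ η ∈ Icc p q, f η - u η ≤ max (f p - u p) (f q - u q) := by
  by_contra hcon
  simp only [not_forall, not_le, exists_prop] at hcon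
  obtain ⟨η₁, hη₁, hlt⟩ := hcon
  -- bounds for the coefficients on `[p, q]`
  have hne : (Icc p q).Nonempty := nonempty_Icc.2 hpq
  obtain ⟨A, hA⟩ := isCompact_Icc.exists_bound_of_continuousOn hα
  obtain ⟨ηm, hηm, hmin⟩ := isCompact_Icc.exists_isMinOn hne hβ
  have hβ₀pos : 0 < β ηm := hβ0 ηm hηm
  have hβge : ∀ η ∈ Icc p q, β ηm ≤ β η := fun η hη ↦ hmin hη
  have hA0 : 0 ≤ A := (norm_nonneg _).trans (hA ηm hηm)
  -- the exponential perturbation `g = exp (K ·)`, a strict subsolution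
  obtain ⟨K, hK⟩ : ∃ K : ℝ, K = 2 * A / β ηm + 1 := ⟨_, rfl⟩
  have hKpos : 0 < K := by rw [hK]; positivity
  obtain ⟨g, hg⟩ : ∃ g : ℝ → ℝ, g = fun η ↦ Real.exp (K * η) := ⟨_, rfl⟩
  have hgpos : ∀ η, 0 < g η := fun η ↦ by rw [hg]; exact Real.exp_pos _
  have hgc : Continuous g := by rw [hg]; fun_prop
  have hgen : ∀ η ∈ Icc p q, K * β ηm / 2 * g η ≤ β η / 2 * (K ^ 2 * g η) + α η * (K * g η) := by
    intro η hη
    have h1 : β ηm ≤ β η := hβge η hη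
    have h2 : |α η| ≤ A := by simpa [Real.norm_eq_abs] using hA η hη
    have h3 : -A ≤ α η := (abs_le.1 h2).1
    have hKβ : K * β ηm / 2 - A = β ηm / 2 := by
      rw [hK]; field_simp; ring
    have : K * β ηm / 2 ≤ β η / 2 * K ^ 2 + α η * K := by
      have hK2 : β ηm / 2 * K ^ 2 ≤ β η / 2 * K ^ 2 := by gcongr
      have hK3 : -A * K ≤ α η * K := by gcongr
      nlinarith [hβ₀pos, hKpos]
    calc K * β ηm / 2 * g η ≤ (β η / 2 * K ^ 2 + α η * K) * g η :=
          mul_le_mul_of_nonneg_right this (hgpos η).le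
      _ = β η / 2 * (K ^ 2 * g η) + α η * (K * g η) := by ring
  -- the size of the perturbation
  obtain ⟨δ, hδ⟩ : ∃ δ : ℝ, δ = f η₁ - u η₁ - max (f p - u p) (f q - u q) := ⟨_, rfl⟩
  have hδpos : 0 < δ := by rw [hδ]; linarith
  have hGpos : 0 < Real.exp (K * q) := Real.exp_pos _
  have hgle : ∀ η ∈ Icc p q, g η ≤ Real.exp (K * q) := fun η hη ↦ by
    rw [hg]; exact Real.exp_le_exp.2 (mul_le_mul_of_nonneg_left hη.2 hKpos.le)
  obtain ⟨ε, hε⟩ : ∃ ε : ℝ, ε = δ / (4 * Real.exp (K * q)) := ⟨_, rfl⟩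
  have hεpos : 0 < ε := by rw [hε]; positivity
  have hεG : ε * Real.exp (K * q) = δ / 4 := by rw [hε]; field_simp
  obtain ⟨wε, hwε⟩ : ∃ wε : ℝ → ℝ, wε = fun η ↦ f η - u η + ε * g η := ⟨_, rfl⟩
  have hwεc : ContinuousOn wε (Icc p q) := by
    rw [hwε]; exact (hf.sub hu).add (continuousOn_const.mul hgc.continuousOn)
  -- an interior maximum point of `wε`
  obtain ⟨ηs, hηs, hmax⟩ := isCompact_Icc.exists_isMaxOn hne hwεc
  have hwεηs : max (f p - u p) (f q - u q) + δ ≤ wε ηs := by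
    have h1 : wε η₁ ≤ wε ηs := hmax hη₁
    have h3 : f η₁ - u η₁ ≤ wε η₁ := by
      rw [hwε]; linarith [mul_pos hεpos (hgpos η₁)]
    linarith
  have hbdry : ∀ η ∈ Icc p q, f η - u η ≤ max (f p - u p) (f q - u q) → wε η < wε ηs := by
    intro η hη hwle
    have : ε * g η ≤ δ / 4 := by
      rw [← hεG]; exact mul_le_mul_of_nonneg_left (hgle η hη) hεpos.le
    have hv : wε η = f η - u η + ε * g η := by rw [hwε]
    linarith
  have hηsI : ηs ∈ Ioo p q := by
    refine ⟨lt_of_le_of_ne hηs.1 ?_, lt_of_le_of_ne hηs.2 ?_⟩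
    · rintro rfl
      exact lt_irrefl _ (hbdry _ (left_mem_Icc.2 hpq) (le_max_left _ _))
    · rintro rfl
      exact lt_irrefl _ (hbdry _ (right_mem_Icc.2 hpq) (le_max_right _ _))
  -- the mean-value property at `ηs`
  obtain ⟨r, e, hr, he, hev⟩ := hmvp ηs hηsI
  have hbpos : 0 < β ηs := hβ0 ηs hηs
  obtain ⟨c, hc⟩ : ∃ c : ℝ, c = β ηs / 2 * (K ^ 2 * g ηs) + α ηs * (K * g ηs) := ⟨_, rfl⟩
  have hcpos : 0 < c := by
    rw [hc]; exact lt_of_lt_of_le (mul_pos (by positivity) (hgpos ηs)) (hgen ηs hηs)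
  obtain ⟨C₁, hC₁⟩ : ∃ C₁ : ℝ,
      C₁ = |u₁ ηs| + |u₂ ηs| / 2 + ε * (|K * g ηs| + |K ^ 2 * g ηs| / 2) := ⟨_, rfl⟩
  have hC₁nn : 0 ≤ C₁ := by rw [hC₁]; positivity
  -- tolerances from continuity of `u₂` and of `g'' = K² g` at `ηs`
  obtain ⟨θu, hθu⟩ : ∃ θu : ℝ, θu = ε * c / (8 * (β ηs + 1)) := ⟨_, rfl⟩
  obtain ⟨θg, hθg⟩ : ∃ θg : ℝ, θg = c / (8 * (β ηs + 1)) := ⟨_, rfl⟩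
  have hθupos : 0 < θu := by rw [hθu]; positivity
  have hθgpos : 0 < θg := by rw [hθg]; positivity
  have hu₂c : ContinuousAt u₂ ηs := hu₂.continuousAt (Ioo_mem_nhds hηsI.1 hηsI.2)
  have hg₂c : ContinuousAt (fun η ↦ K ^ 2 * g η) ηs := (continuous_const.mul hgc).continuousAt
  obtain ⟨ρu, hρupos, hρu⟩ := (Metric.continuousAt_iff.1 hu₂c) θu hθupos
  obtain ⟨ρg, hρgpos, hρg⟩ := (Metric.continuousAt_iff.1 hg₂c) θg hθgpos
  obtain ⟨ρ, hρpos, hρu', hρg', hρp, hρq⟩ :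
      ∃ ρ : ℝ, 0 < ρ ∧ ρ < ρu ∧ ρ < ρg ∧ ρ < ηs - p ∧ ρ < q - ηs := by
    refine ⟨min (min ρu ρg) (min (ηs - p) (q - ηs)) / 2, ?_, ?_, ?_, ?_, ?_⟩
    · have h1 : 0 < ηs - p := sub_pos.2 hηsI.1
      have h2 : 0 < q - ηs := sub_pos.2 hηsI.2
      positivity
    all_goals
      have h1 : 0 < ηs - p := sub_pos.2 hηsI.1
      have h2 : 0 < q - ηs := sub_pos.2 hηsI.2
      have hm : 0 < min (min ρu ρg) (min (ηs - p) (q - ηs)) := by positivity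
    · linarith [min_le_left (min ρu ρg) (min (ηs - p) (q - ηs)), min_le_left ρu ρg]
    · linarith [min_le_left (min ρu ρg) (min (ηs - p) (q - ηs)), min_le_right ρu ρg]
    · linarith [min_le_right (min ρu ρg) (min (ηs - p) (q - ηs)), min_le_left (ηs - p) (q - ηs)]
    · linarith [min_le_right (min ρu ρg) (min (ηs - p) (q - ηs)), min_le_right (ηs - p) (q - ηs)]
  have hIccsub : Icc (ηs - ρ) (ηs + ρ) ⊆ Ioo p q := fun y hy ↦
    ⟨by linarith [hy.1], by linarith [hy.2]⟩
  have hIccsub' : Icc (ηs - ρ) (ηs + ρ) ⊆ Icc p q := fun y hy ↦ Ioo_subset_Icc_self (hIccsub hy)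
  -- moduli of continuity on `[-ρ, ρ]`
  have hmodu : ∀ x ∈ Icc (-ρ) ρ, |u₂ (ηs + x) - u₂ ηs| ≤ θu := by
    intro x hx
    have : dist (ηs + x) ηs < ρu := by
      rw [Real.dist_eq, add_sub_cancel_left]
      exact (abs_le.2 ⟨hx.1, hx.2⟩).trans_lt hρu'
    exact le_of_lt (by simpa [Real.dist_eq] using hρu this)
  have hmodg : ∀ x ∈ Icc (-ρ) ρ, |K ^ 2 * g (ηs + x) - K ^ 2 * g ηs| ≤ θg := by
    intro x hx
    have : dist (ηs + x) ηs < ρg := by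
      rw [Real.dist_eq, add_sub_cancel_left]
      exact (abs_le.2 ⟨hx.1, hx.2⟩).trans_lt hρg'
    exact le_of_lt (by simpa [Real.dist_eq] using hρg this)
  -- derivative data for `u` and `g` on `[ηs - ρ, ηs + ρ]`
  have hud' : ∀ y ∈ Icc (ηs - ρ) (ηs + ρ), HasDerivAt u (u₁ y) y := fun y hy ↦ hud y (hIccsub hy)
  have hu₁d' : ∀ y ∈ Icc (ηs - ρ) (ηs + ρ), HasDerivAt u₁ (u₂ y) y := fun y hy ↦ hu₁d y (hIccsub hy)
  have hgd : ∀ y : ℝ, HasDerivAt g (K * g y) y := by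
    intro y
    rw [hg]
    exact (((hasDerivAt_id y).const_mul K).exp).congr_deriv (by simp; ring)
  have hg₁d : ∀ y : ℝ, HasDerivAt (fun y ↦ K * g y) (K ^ 2 * g y) y := fun y ↦
    ((hgd y).const_mul K).congr_deriv (by ring)
  -- eventually: `r n ≤ ρ`, `e n` small, `n ≥ 1`, and the measure `ν_n` exists
  have hr' : ∀ᶠ n : ℕ in atTop, r n ≤ ρ := by
    filter_upwards [hr.eventually (Iio_mem_nhds hρpos)] with n hn using le_of_lt hn
  have he' : ∀ᶠ n : ℕ in atTop, |e n| ≤ min 1 (ε * c / (8 * (C₁ + 1))) := by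
    have hpos : 0 < min 1 (ε * c / (8 * (C₁ + 1))) := by positivity
    filter_upwards [he.eventually (Metric.closedBall_mem_nhds (0 : ℝ) hpos)] with n hn
    simpa [Real.dist_eq] using hn
  obtain ⟨n, ⟨⟨hνn, hrn⟩, hen⟩, hn⟩ := (((hev.and hr').and he').and (eventually_ge_atTop 1)).exists
  obtain ⟨ν, hνP, hsupp, hfid, hm₁, hm₂⟩ := hνn
  have hnpos : (0 : ℝ) < n := by exact_mod_cast hn
  have hn2pos : (0 : ℝ) < (n : ℝ) ^ 2 := by positivity
  have he1 : |e n| ≤ 1 := hen.trans (min_le_left _ _)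
  have he2 : |e n| ≤ ε * c / (8 * (C₁ + 1)) := hen.trans (min_le_right _ _)
  have hm₂le : ∫ x, x ^ 2 ∂ν ≤ (β ηs + 1) / (n : ℝ) ^ 2 := by
    have h1 : (∫ x, x ^ 2 ∂ν) - β ηs / (n : ℝ) ^ 2 ≤ e n / (n : ℝ) ^ 2 := (le_abs_self _).trans hm₂
    have h2 : e n ≤ 1 := (le_abs_self _).trans he1
    have h3 : e n / (n : ℝ) ^ 2 ≤ 1 / (n : ℝ) ^ 2 := by gcongr
    rw [add_div]
    linarith
  have hm₂nn : 0 ≤ ∫ x, x ^ 2 ∂ν := integral_nonneg fun x ↦ sq_nonneg x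
  -- Taylor expansions of `u` and `g` against `ν`, with the main terms isolated
  have hTu := abs_integral_shift_sub_main_le' (ν := ν) hθupos.le hud' hu₁d' hmodu hrn hsupp hm₁ hm₂
  have hTg := abs_integral_shift_sub_main_le' (ν := ν) (u := g) (u₁ := fun y ↦ K * g y)
    (u₂ := fun y ↦ K ^ 2 * g y) hθgpos.le (fun y _ ↦ hgd y) (fun y _ ↦ hg₁d y) hmodg hrn hsupp
    hm₁ hm₂
  -- integrability of the pieces and the maximum inequality
  have hIf := integrable_shift_of_continuousOn (ν := ν) (hf.mono hIccsub') hrn hsupp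
  have hIu := integrable_shift_of_continuousOn (ν := ν) (hu.mono hIccsub') hrn hsupp
  have hIg : Integrable (fun x ↦ g (ηs + x)) ν :=
    integrable_shift_of_continuousOn (ν := ν) (ρ := ρ) hgc.continuousOn hrn hsupp
  have hIfu : Integrable (fun x ↦ f (ηs + x) - u (ηs + x)) ν := hIf.sub hIu
  have hIεg : Integrable (fun x ↦ ε * g (ηs + x)) ν := hIg.const_mul ε
  have hIw : Integrable (fun x ↦ wε (ηs + x)) ν := by rw [hwε]; exact hIfu.add hIεg
  have hmaxI : ∫ x, wε (ηs + x) ∂ν ≤ wε ηs := by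
    have hle : ∀ᵐ x ∂ν, wε (ηs + x) ≤ wε ηs := by
      filter_upwards [ae_mem_Icc_of_compl_null hsupp] with x hx
      exact hmax (hIccsub' ⟨by linarith [hx.1, hrn], by linarith [hx.2, hrn]⟩)
    calc ∫ x, wε (ηs + x) ∂ν ≤ ∫ _, wε ηs ∂ν := integral_mono_ae hIw (integrable_const _) hle
      _ = wε ηs := by simp
  -- the integral of `wε (ηs + ·)` in terms of the pieces
  have hsplit : ∫ x, wε (ηs + x) ∂ν - wε ηs =
      -(∫ x, u (ηs + x) ∂ν - u ηs) + ε * (∫ x, g (ηs + x) ∂ν - g ηs) := by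
    have h1 : ∫ x, wε (ηs + x) ∂ν = ∫ x, (f (ηs + x) - u (ηs + x)) + ε * g (ηs + x) ∂ν := by
      rw [hwε]
    rw [h1, integral_add hIfu hIεg, integral_sub hIf hIu, integral_const_mul, ← hfid, hwε]
    ring
  -- the main terms: `u₁ a + u₂ b / 2 = 0` (the ODE) and `K g a + K² g b / 2 = c`
  have hodeηs : u₁ ηs * α ηs + u₂ ηs / 2 * β ηs = 0 := by linarith [hode ηs hηsI]
  have hcg : K * g ηs * α ηs + K ^ 2 * g ηs / 2 * β ηs = c := by rw [hc]; ring
  rw [hodeηs, zero_div, sub_zero] at hTu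
  rw [hcg] at hTg
  -- lower bound for the integral minus the value
  have key : ε * c / (n : ℝ) ^ 2 - C₁ * (e n / (n : ℝ) ^ 2) - (θu + ε * θg) * ∫ x, x ^ 2 ∂ν ≤
      ∫ x, wε (ηs + x) ∂ν - wε ηs := by
    rw [hsplit]
    have Hu := (abs_le.1 hTu).2
    have Hg := (abs_le.1 hTg).1
    have hεHg := mul_le_mul_of_nonneg_left Hg hεpos.le
    have hC₁e : C₁ * (e n / (n : ℝ) ^ 2) = (|u₁ ηs| + |u₂ ηs| / 2) * (e n / (n : ℝ) ^ 2) +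
        ε * ((|K * g ηs| + |K ^ 2 * g ηs| / 2) * (e n / (n : ℝ) ^ 2)) := by rw [hC₁]; ring
    exact key_arith hεpos.le Hu Hg hC₁e
  -- the lower bound is positive
  have hpos : 0 < ε * c / (n : ℝ) ^ 2 - C₁ * (e n / (n : ℝ) ^ 2) -
      (θu + ε * θg) * ∫ x, x ^ 2 ∂ν := by
    have h1 : C₁ * (e n / (n : ℝ) ^ 2) ≤ ε * c / 8 / (n : ℝ) ^ 2 := by
      have : C₁ * e n ≤ ε * c / 8 := by
        have h := (le_abs_self _).trans he2
        calc C₁ * e n ≤ C₁ * (ε * c / (8 * (C₁ + 1))) := mul_le_mul_of_nonneg_left h hC₁nn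
          _ = ε * c / 8 * (C₁ / (C₁ + 1)) := by field_simp
          _ ≤ ε * c / 8 * 1 := by
            gcongr
            exact (div_le_one (by positivity)).2 (by linarith)
          _ = ε * c / 8 := mul_one _
      calc C₁ * (e n / (n : ℝ) ^ 2) = C₁ * e n / (n : ℝ) ^ 2 := by ring
        _ ≤ ε * c / 8 / (n : ℝ) ^ 2 := by gcongr
    have h2 : (θu + ε * θg) * ∫ x, x ^ 2 ∂ν ≤ ε * c / 4 / (n : ℝ) ^ 2 := by
      have hsum : θu + ε * θg = ε * c / (4 * (β ηs + 1)) := by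
        rw [hθu, hθg]; field_simp; ring
      rw [hsum]
      calc ε * c / (4 * (β ηs + 1)) * ∫ x, x ^ 2 ∂ν
          ≤ ε * c / (4 * (β ηs + 1)) * ((β ηs + 1) / (n : ℝ) ^ 2) :=
            mul_le_mul_of_nonneg_left hm₂le (by positivity)
        _ = ε * c / 4 / (n : ℝ) ^ 2 := by field_simp
    have h3 : ε * c / (n : ℝ) ^ 2 - ε * c / 8 / (n : ℝ) ^ 2 - ε * c / 4 / (n : ℝ) ^ 2 =
        (5 / 8) * (ε * c) / (n : ℝ) ^ 2 := by ring
    have h4 : 0 < (5 / 8) * (ε * c) / (n : ℝ) ^ 2 := by positivity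
    linarith
  linarith

/-- **Registered form** (glue sub-goal `kernelODE_sub_le_max_of_mvp` of stmt-CriticalPhenomena-0746): the
maximum principle for continuous kernels with the asymptotic mean-value property relative to `C²`
solutions of the generator equation. [folklore] -/
theorem kernelODE_sub_le_max_of_mvp : ∀ {f u u₁ u₂ α β : ℝ → ℝ} {p q : ℝ}, p ≤ q → ContinuousOn f (Set.Icc p q) → ContinuousOn u (Set.Icc p q) → (∀ η ∈ Set.Ioo p q, ∃ r e : ℕ → ℝ, Filter.Tendsto r Filter.atTop (nhds 0) ∧ Filter.Tendsto e Filter.atTop (nhds 0) ∧ ∀ᶠ n : ℕ in Filter.atTop, ∃ ν : MeasureTheory.Measure ℝ, MeasureTheory.IsProbabilityMeasure ν ∧ ν (Set.Icc (-(r n)) (r n))ᶜ = 0 ∧ f η = ∫ x, f (η + x) ∂ν ∧ |∫ x, x ∂ν - α η / (n : ℝ) ^ 2| ≤ e n / (n : ℝ) ^ 2 ∧ |∫ x, x ^ 2 ∂ν - β η / (n : ℝ) ^ 2| ≤ e n / (n : ℝ) ^ 2) → ContinuousOn α (Set.Icc p q) → ContinuousOn β (Set.Icc p q) → (∀ η ∈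 Set.Icc p q, 0 < β η) → (∀ η ∈ Set.Ioo p q, HasDerivAt u (u₁ η) η) → (∀ η ∈ Set.Ioo p q, HasDerivAt u₁ (u₂ η) η) → ContinuousOn u₂ (Set.Ioo p q) → (∀ η ∈ Set.Ioo p q, β η / 2 * u₂ η + α η * u₁ η = 0) → ∀ η ∈ Set.Icc p q, f η - u η ≤ max (f p - u p) (f q - u q) :=
  fun hpq hf hu hmvp hα hβ hβ0 hud hu₁d hu₂ hode ↦
    sub_le_max_of_mvp hpq hf hu hmvp hα hβ hβ0 hud hu₁d hu₂ hode

end KernelODE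

end Summit.CriticalPhenomena.CardyFormulaZ2.Cruxes.CardyRigidity.CrossingMartingale

end
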